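import Mathlib
import HarnessLib
import HarnessLib.Audit
import Summits.ValiantsHypothesis.Statement
import Literature.Computability.AlgebraicComplexity.DeterminantalComplexity
import Literature.Computability.AlgebraicComplexity.HessianRank
import Literature.Computability.AlgebraicComplexity.VPDeterminantalQPProofs
import Literature.Computability.AlgebraicComplexity.ValiantConjectureProofs
import Literature.Computability.AlgebraicComplexity.EquivariantDC
import Literature.Computability.AlgebraicComplexity.SymmetricArithCircuit
import Summits.ValiantsHypothesis.ValiantsHypothesis.Theorems.ProofCarryingSymmetrySquareSymmetricPermLB
import HarnessLib.Audit.Status.Attr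

/-!
Route: SymPencil

# Route SymPencil — symmetric pencils — one kernel line doubles Mignon–Ressayre (sdc(per_n) ≥ n²)
and sdc(per_n) is not quasi-polynomially bounded

X (SYMMETRIC DETERMINANTAL COMPLEXITY OF THE PERMANENT IS NOT QUASI-POLYNOMIALLY BOUNDED): there is
no constant c such
that for every n the permanent per_n ∈ ℂ[x_ij] is det(A) for a SYMMETRIC matrix A of affine-linear
forms of size
m ≤ 2^((log₂ n + c)^c). Here sdc(f) = least size of a symmetric affine determinantal representation
(arXiv:1007.3804 §1.1,
arXiv:2606.11090 §1.1); Lean lacks the notion, so every item inlines `A.IsSymm ∧ IsAffineDetRepr f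
A`. Realises card
one-kernel-line-sdc (spine). X is VH-relevant and VH-equivalent to DetQP's dc-thesis up to
polynomial distortion
(dc ≤ sdc ≤ 4·dc³ + 7), but the symmetric model's local lower-bound engines are provably twice as
strong.
Lean: `¬ ∃ c : ℕ, ∀ n : ℕ, ∃ m ≤ 2 ^ ((Nat.log 2 n + c) ^ c), ∃ A : Matrix (Fin m) (Fin m)
(MvPolynomial (Fin n × Fin n) ℂ), A.IsSymm ∧
Literature.Computability.AlgebraicComplexity.IsAffineDetRepr
(Literature.Computability.AlgebraicComplexity.perPoly (Fin n) ℂ) A`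

## Assembly
Bookkeeping over PROVED tree facts, no open Literature fact in the import cone: assume VP ℂ = VNP ℂ;
then perFamily ℂ ∈ VP ℂ
(per ∈ VNP, `perFamily_mem_VNP_holds`), so the permanent is a VP family (renaming bridge,
`mem_VP_ofFintype_iff_holds`), so
dc(per_n) ≤ 2^((log₂ n + c)^c) (`isQPBounded_determinantalComplexity_of_isVPFamily_holds`) and the
bound is attained by an actual
representation (`hasDetRepr_determinantalComplexity_holds`); SdcOfDc turns it into a symmetric one
of size ≤ 4·2^(3(log₂ n + c)^c) + 7
≤ 2^((log₂ n + c + 3)^(c+3)), contradicting SdcThesis. The three Literature facts are inlined as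
hypotheses exactly as in DetQP's
assembly, and the hub is filed separately (HubPerNotVp) for reuse.

Rationale: WHY THIS LINE. Make the pencil symmetric and one of Mignon–Ressayre's two kernel lines disappears:
at a smooth point x of Z(det L), L = A₀ + Σ xᵢAᵢ
symmetric of size m, adj L(x) = c·uuᵀ, so ∇f(x) = c·(uᵀAᵢu)ᵢ and the Gauss map of Z(f) factors
through ONE kernel line [u] ∈ P^{m−1}
followed by a fixed quadratic map (arXiv:2606.11090 uses this incidence for SMOOTH hypersurfaces and
power sums; Landsberg2017 §6.4.5 /
arXiv:1004.4802 is the two-line version behind dc(per_n) ≥ n²/2, MignonRessayre2004). Because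
Z(per_n)^∨ is a hypersurface (full-rank
Hessian at the Mignon–Ressayre point, tree `rank_mrHess`, plus Segre's formula Landsberg2017 Prop
6.4.5.1) the dimension count gives
sdc(per_n) ≥ n² − 1 at once — equivalently: the Hessian of the symmetric determinant restricted to
Sym_m at a singular point has rank
m + 1 instead of 2m — and the cone direction pushes it to n²: double the 2004 record, provable now,
in a model that is VH-equivalent
(dc ≤ sdc ≤ 4dc³ + 7 by arXiv:1007.3804 Thm 5), so X ⇒ dc(per_n) not qp-bounded ⇒ per ∉ VP (tree
fact
isQPBounded_determinantalComplexity_of_isVPFamily, proved) ⇒ VH (hub). Imported area: classical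
projective duality / Gauss maps of
discriminant hypersurfaces (the dual of the symmetric determinant is the quadratic Veronese) and the
real-algebraic-geometry literature on
symmetric / LMI determinantal representations (Helton–Vinnikov, Quarez, GKKP arXiv:1007.3804,
Netzer–Thom doi:10.1016/j.laa.2012.04.043)
which supplies the model and its upper bounds; no probabilistic or spectral reformulation is used.
What it does that DetQP and the
(empty) negatives index do not: it changes the MODEL so that the same local invariants land exactly
on the #variables wall N = n²,
making "one more than N" (SdcPerBeyondN) the sharpest available test of whether pencil geometry
carries third-order information, and
it runs the super-quadratic bet through the symmetric kernel incidence (class of the dual via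
Sheshadri's Bezout, or sums of squares of
quadrics at Taylor order 4) rather than through flattening ranks.

RANKED CRUXES. #0 SdcThesis (target) — X as in § Thesis: no c with sdc(per_n) ≤ 2^((log₂ n + c)^c)
for all n (symmetric affine determinantal representations over ℂ). (why it might fail: Via dc ≤ sdc
≤ 4dc³+7 (GKKP Thm 5) X is the Extended Valiant Hypothesis VNP ⊄ VQP in disguise — strictly stronger
than VH; it fails if per_n is a qp-projection of DET (dc(per_n) = n^{O(log n)} is compatible with VP
≠ VNP).) [arXiv:1007.3804, BurgisserClausenShokrollahi1997, MignonRessayre2004, Grenet2011]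
#2 SdcSuperquadratic (crux) — there is ε > 0 such that, for all large n, every symmetric affine
determinantal representation of per_n over ℂ has size ≥ n^(2+ε) (card item S4: the first bound past
the quadratic / #variables wall in any determinantal model; sdc-version of
DetQP.DetqpSuperquadratic, which implies it). [deps: SdcPerSq, SdcPerBeyondN] [difficulty: XL] (why
it might fail: Every pointwise engine saturates at N = n²: Hessian rank (m+1), kernel-line dimension
(n²), strength/sos-length of Taylor forms (≤ #variables); Landsberg2017 Rem 6.4.6.5. Past N only the
class of Z(per_n)^∨ (unknown, may collapse det-like) is in sight; sdc(per_n) = O(n²) is excluded by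
nothing.) [MignonRessayre2004, Landsberg2017, arXiv:2606.11090, arXiv:2009.02452, arXiv:1004.4802,
EfremenkoLandsbergSchenckWeyman2018]
#3 SdcPerSq (crux) — for n ≥ 3 every symmetric affine determinantal representation of per_n over ℂ
has size ≥ n² (card S1 sharpened by one). Proof line: one kernel line (OneKernelLine) ⇒ the Gauss
image of Z(per_n) lies in the image of the quadratic map Q(u) = (uᵀAᵢu)ᵢ restricted to the kernel
variety K ⊂ P^{m−1}; Z(per_n)^∨ is a hypersurface (rank Hess per_n = n² at the MR point + Segre Prop
6.4.5.1 + irreducibility of per_n) ⇒ dim K ≥ n² − 2 ⇒ m ≥ n² − 1; along the cone line λx the tangent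
hyperplane is fixed but the kernel u_{λx} = ker(A₀ + λM(x)) moves unless A₀u_x = 0, so either
general fibres of Q|K are ≥ 1-dimensional (m ≥ n²) or A₀ kills span K (A₀ = 0 would make per_n
homogeneous of degree m ≥ n² − 1 > n; span K proper forces dim K ≤ m − 2, again m ≥ n²). [deps:
HessianRankSymmDet, OneKernelLine, SdcPerSqPred] [difficulty: L] (why it might fail: The final +1
rests on a sketched generic-fibre/cone argument (u_{λx} moves unless A₀u_x = 0; case split on span
K) checked only on paper; a gap drops the claim to n² − 1, which is solid (HessianRankSymmDet +
rank_mrHess). Formal risk: dual-variety dimension theory is not in Mathlib.) [Landsberg2017,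
MignonRessayre2004, arXiv:1004.4802, arXiv:2606.11090]
#4 SdcPerBeyondN (crux) — for n ≥ 3 every symmetric affine determinantal representation of per_n
over ℂ has size ≥ n² + 1 — the symmetric model crosses the number-of-variables wall (cf.
arXiv:2009.02452: the only explicit dc bound beyond #variables is 1.5n − 3 for power sums). At m =
n² the kernel-line geometry forces K = P^{m−1} and Z(per_n)^∨ = closure of the image of the
quadratic map [uᵀAᵢu]: refuting that structure is the whole content; for n ≥ 4 a near-smooth class
of Z(per_n)^∨ (> 2^{n²−2}·n² via Sheshadri's count extended to singular X) would do it, for n = 3 it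
cannot (class ≤ 384 < 1152). [deps: SdcPerSq] [difficulty: L] (why it might fail: At m = n² nothing
known obstructs: K = P^{m−1} with Z(per_n)^∨ the image of a quadratic map is consistent, and for n =
3 even the full class (≤ 384 < 2^7·9) cannot exclude a 9×9 symmetric pencil — one such pencil for
per_3 refutes the crux as stated (then restate for n ≥ 4).) [arXiv:2009.02452, arXiv:2606.11090,
AlperBogartVelasco2017, Landsberg2017, arXiv:1007.3804]
#9 HessianRankSymmDet (support) — symmetric Mignon–Ressayre lemma: if f = det A with A a symmetric
m×m matrix of affine-linear forms over ℂ and f(x) = 0, then rank Hess f(x) ≤ m + 1. Proof: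
congruence normal form of the singular symmetric matrix A(x) (det(PᵀMP) = det(P)² det M keeps the
pencil symmetric); at diag(0,1,…,1) the quadratic part of det(Y+Z), Z symmetric, is z₁₁·Σ_{j≥2} z_jj
− Σ_{j≥2} z_{1j}², of rank 2 + (m−1) = m+1; corank 2 gives z₁₁z₂₂ − z₁₂² (rank 3), corank ≥ 3 gives
0; then the affine chain rule `hessianMatrix_aeval_C_add_linear` (tree) with columns in Sym_m. The
dc-analogue in the tree is rank ≤ 2m (`rank_hessianMatrix_le_two_mul_determinantalComplexity`).
[difficulty: provable-now] [MignonRessayre2004, CaiChenLi2010, Landsberg2017, arXiv:2202.13016]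
#9 SdcPerSqPred (support) — the solid fallback of SdcPerSq and the card's S1: for n ≥ 3 every
symmetric affine determinantal representation of per_n has size ≥ n² − 1 — HessianRankSymmDet at the
Mignon–Ressayre zero of per_n where the Hessian has rank n² (tree `rank_mrHess`,
`hess0_transl_mrPoint_perPoly`), exactly as `sq_le_two_mul_of_hasDetRepr_perPoly` does for dc.
Already double the dc record n²/2. [difficulty: provable-now] [MignonRessayre2004, Landsberg2017,
Literature.Computability.AlgebraicComplexity.rank_mrHess (MignonRessayreBound.lean)]
#9 OneKernelLine (support) — one kernel line (Jacobi's formula + symmetric rank one): if f = det A,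
A symmetric affine of size m over ℂ, and f(x) = 0, then there is u ∈ ℂ^m with ∂ᵢf(x) = uᵀAᵢu for
every variable i, where Aᵢ = (coefficient of Xᵢ in A_jl)_jl is the (symmetric) linear part; corank
1: adj A(x) = c·uuᵀ and √c is absorbed into u; corank ≥ 2: both sides vanish (u = 0). This is the
factorisation of the Gauss map through P^{m−1} that names the card. [difficulty: provable-now]
[arXiv:2606.11090, Landsberg2017]
#9 SdcOfDc (support) — known transfer (GKKP 2011 Thm 5, Mahajan–Nimbhorkar; Thm 4 for weakly-skew
circuits): DET_m is the determinant of a SYMMETRIC matrix of size 4m³ + 7 whose entries are the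
variables x_ij and constants in {0, ±1, 1/2}; substituting the affine entries of any size-m affine
determinantal representation of f gives a symmetric one of size ≤ 4m³ + 7 (pad with an identity
block for ≤). Makes X ⟺ DetQP.DetqpThesis up to polynomial distortion and is the load-bearing
hypothesis of the Assembly; expected to become a Literature named fact. [difficulty: L]
[arXiv:1007.3804, GrenetEtAl2011]
#9 SdcPerThreeTen (support) — the n = 3 instance of SdcPerBeyondN and the route's cheapest finite
test: per_3 has no symmetric affine determinantal representation of size ≤ 9 (dc(per_3) = 7 by
AlperBogartVelasco2017; SdcPerSq gives ≥ 9; an upper bound of a few dozen follows from GKKP Thm 4 on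
Grenet's 7-vertex ABP or Thm 3 on Ryser's formula). Refuters: numerical search for a 9×9 symmetric
pencil (450 unknowns); provers: a certificate that the quadratic map structure Z(per_3)^∨ = image of
[uᵀAᵢu] on P^8 is impossible. [difficulty: M] [AlperBogartVelasco2017, arXiv:1007.3804, Grenet2011]
#9 HubPerNotVp (support) — shared hub of all permanent-based routes (identical to DetQP.HubPerNotVp;
proved in Summits/ValiantsHypothesis/ValiantsHypothesis/Theorems/HubHub.lean): if the permanent
family over ℂ is not a VP family then VP ℂ ≠ VNP ℂ, given the renaming bridge and per ∈ VNP.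
[difficulty: provable-now] [Valiant1979, Burgisser2000, BurgisserClausenShokrollahi1997]

TWO-LAYER PLAN. Foreseen glued splits (nothing filed now; k ≤ 3, depth 1):
SdcPerSq ⇐ DualHypersurface (dim of the closure of ∇per_n(Z(per_n)) is n² − 1: rank_mrHess + Segre
Prop 6.4.5.1 + irreducibility) →
KernelConeStep (the A₀-dichotomy along the cone line) → SdcPerSq.
SdcSuperquadratic ⇐ ClassLowerBound (class of Z(per_n)^∨ ≥ (εn)^{n²}; this is the sibling card
class-conjecture-superquadratic-dc, to be
shared if that card is routed) → SingularSymmetricBezout (Sheshadri Thm 1 without smoothness: class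
≤ 2^{N−2}·C(sdc, N−1) for concise f
with nondegenerate dual) → SdcSuperquadratic (yields c·n³); alternative child in place of
ClassLowerBound: the symmetric order-4 normal
form T₄ ≡ −Σ_{k<m} Q_k² mod (T₁, T₂-corrections) at the MR point plus an sos-length lower bound
n^{2+ε} for the reduced quartic of per_n.
SdcPerBeyondN ⇐ the n ≥ 4 enumerative child (class(Z(per_4)^∨) > 2^{14}·16 by certified numerical
AG) → a separate n = 3 argument or
a restatement to n ≥ 4 → SdcPerBeyondN.

KILL CRITERIA. A symmetric (equivalently, by SdcOfDc, any) affine determinantal representation of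
per_n of size 2^{polylog n} refutes SdcThesis:
close `refuted:SdcThesis` (DetQP dies with it; VH survives only via non-determinantal routes). A 9×9
symmetric pencil for per_3
refutes SdcPerBeyondN and SdcPerThreeTen as stated: restate SdcPerBeyondN for n ≥ 4 (enumerative
child) and record that the
symmetric model is tight at N for n = 3. A size-(n²−1) symmetric pencil for some per_n, n ≥ 3,
refutes SdcPerSq: restate to the solid
SdcPerSqPred (the +1 argument was wrong). The enumerative engine dies if class(Z(per_n)^∨) ≤
n^{o(n²)} (det-like collapse; first
signal: class(P_4) ≪ 4·3^{14}); the order-4 engine dies if the reduced quartic of per_n at the MR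
point has sos-length O(n²); both dead
⇒ route dormant at the n² rung (SdcPerSq / SdcPerSqPred still worth landing as theorems). Mooted,
not killed: dc(per_n) ≥ n^{2+ε} proved
in DetQP implies SdcSuperquadratic (sdc ≥ dc).

NOT DECOMPOSED YET. The dual-variety / Segre–Katz dimension statement and the generic-corank-1 lemma
(children of SdcPerSq; provers may attach them with
--supports); the class conjecture and the singular extension of Sheshadri's multihomogeneous Bezout
(sibling card, possibly its own route;
needs a Lean notion of class / top polar degree); the symmetric order-4 Taylor normal form and
sos-length (needs a definition; only after
SdcPerSq lands); the hafnian analogue (card S5: sdc(haf_2n) ≥ 2n² − n − 1 if its Hessian is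
nondegenerate on Z(haf)) — a side computation
feeding no assembly here; border / orbit-closure (GCT) versions of sdc — another route family; the
exact value of sdc(per_3).

CHEAPEST FALSIFIER. Numerical search (kit, hours; not run — plancard payload carries no kit and the
hub is compute-free): minimise Σ_p |det(A₀ + Σ x_ij(p)Aᵢⱼ) −
per_3(p)|² over symmetric 9×9 pencils (10 symmetric matrices, 450 unknowns) on ≥ 500 random points p
∈ ℂ⁹, from many random starts,
then certify a hit exactly by coefficient comparison (per_3: 6 of the 165 cubic monomials, all lower
coefficients 0). A hit refutes
SdcPerBeyondN/SdcPerThreeTen; a hit at size 8 refutes SdcPerSq; a hit at size 7 would refute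
SdcPerSqPred and expose an error in the
Hessian lemma. Lookup falsifier (run, negative): is "rank Hess ≤ sdc + 1" / "sdc(per_n) ≥ n² − 1"
already printed? — GKKP §5 compares
only upper bounds for per, Netzer–Thom/Quarez treat existence and generic counts, Sheshadri 2026
treats smooth V(f) and power sums,
Landsberg2017 ch. 6 has no symmetric determinant.

NUMBERS. sdc(per_4): 27 ≤ sdc(per₄) ≤ 29 UNCONDITIONAL over characteristic 0 — tree
`sdc_perPoly_four_window_twentySeven` and `twentySeven_le_of_isSymm_isAffineDetRepr_perPoly_four`
(p602870 Theorems/SymPencilSdcPerFourWindowTwentySeven.lean @5178d5a8b093, 2026-08-28T03:41Z,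
val-width 5676-p2 g5 with 5674-p3 g2; director-valiant g11 R54): lower lane = the six-dimensional
cell hypothesis H106 (`SymPencilPerFourSixDimNoJointFamily.noJointFamily_six`: no 6-dimensional V ⊆
Sing Z(per_4) carries a joint family with fewer than six squares) + `twentySeven_le_of_H106₅`
(one-row kernel cells (12,4,0), (12,4,1) empty by the base-point expansion of the pencil), after the
cell's earlier walls 16 → 26; upper lane = the explicit 29 × 29 symmetric pencil of
`SymPencilSdcPerFourTwentyNine`; OPEN SIZES 27, 28 (the six-cell wall at m = 27 is the cell's next
task, 5676-p2 / val-width-5674-w2). This is an n = 4 CALIBRATION VALUE for #2 SdcSuperquadratic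
(stmt-5674, superquadratic in n, OPEN) — rung currency only, no item closes, VP ≠ VNP not moved.
dc(per_n) ≥ n²/2 (MignonRessayre2004; tree
`sq_le_two_mul_determinantalComplexity_perPoly_complex_holds`); dc(per_3) = 7
(AlperBogartVelasco2017); dc(per_n) ≤ 2^n − 1 (Grenet2011; tree
`determinantalComplexity_perPoly_le_holds`); sdc ≤ 2·(fat weakly-skew
size) + 1 and DET_m symmetric of size 4m³ + 7 (arXiv:1007.3804 Thm 4, Thm 5), hence sdc(per_n) ≤
O(n·2^n) via Grenet's ABP
(n·2^{n−1} edges) — estimate, to be pinned by whoever proves SdcOfDc; Hessian of det_m at a corank-1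
point: rank 2m (MR04) versus m + 1
for the symmetric determinant on Sym_m (this route); rank Hess per_n = n² at the MR point for n ≥ 3
(tree `rank_mrHess`); Sheshadri:
class ≤ 2^{N−2}·C(sdc, N−1) for smooth V(f) (arXiv:2606.11090 Thm 1); smooth class value for degree
n in P^{n²−1}: n(n−1)^{n²−2};
n = 3: class(P_3) ≤ 384 < 2^7·9 = 1152 (enumerative engine cannot reach SdcPerThreeTen); n = 4:
4·3^{14} ≈ 1.9·10^7 versus
2^{14}·16 ≈ 2.6·10^5 at m = 16 (it can, if class(P_4) is within a factor 70 of the smooth value).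
Only explicit dc bound beyond

DEFINITION REQUESTS. - `symmDeterminantalComplexity` with `HasSymmDetRepr f m := ∃ A : Matrix (Fin
m) (Fin m) (MvPolynomial σ k), A.IsSymm ∧ IsAffineDetRepr f A`
  and `sdc f := sInf {m | HasSymmDetRepr f m}` (topic Literature/Computability/AlgebraicComplexity;
arXiv:1007.3804 §1.1, arXiv:2606.11090 §1.1,
  char ≠ 2 existence by GKKP Thm 2/4). Filed after open with `ledger workitem add --kind
definition`; every item above inlines the body, so
  nothing waits on it.
- cite fact wanted (later, by a grounder): GKKP 2011 Thm 5 (DET_n = det of a symmetric matrix of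
size 4n³ + 7) as a Literature named fact
  discharging SdcOfDc; class / top polar degree of a projective hypersurface (needed only for the
enumerative children).

Novelty: Searches (2026-08-15): `lit search --source zbmath "symmetric determinantal representation"` (15:
Netzer–Thom LAA 2012
doi:10.1016/j.laa.2012.04.043, Netzer–Plaumann–Thom 2013, Plaumann–Sturmfels–Vinzant 2012,
Plaumann–Vinzant 2013 — existence and size
for real-zero / hyperbolic polynomials, nothing on the permanent); `lit galaxy search "symmetric
determinantal representation" --star all`
(10: GKKP HAL ensl-00504925, spectrahedral/LMI papers arXiv:1907.13611, Buckley–Košir — no lower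
bounds for per);
`lit search --hybrid "symmetric determinantal complexity permanent lower bound"` (Landsberg2017
pp.155–194, BCS97 — no sdc);
`lit frontier ValiantsHypothesis --since 2022` (30 rows; relevant arXiv:2606.11090,
arXiv:2606.13628, doi:10.1007/s00224-025-10253-8,
arXiv:2604.28019 = Barvinok's symmetrized determinant, unrelated); `lit read arXiv:1007.3804`
pp.3–22 (Thms 2–5; §5 compares UPPER bounds
for per_n only); `lit read book:landsberg2017` pp.168–173 (Prop 6.4.5.1, Ex 6.4.5.2, §6.4.6, Thm
6.4.6.4, Rem 6.4.6.5; grep "symmetric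
determinant": 0 hits); `lit read arXiv:2606.11090` pp.1–5 (smooth V(f), power sums; no dimension
bound, per not treated);
`lit read arXiv:2202.13016` (generalized permanents, dc only); openalex / arxiv / s2 remote tiers:
HTTP 429 all session; `ledger negatives`: 0.
Nearest prior art found: arXiv:2606.11090 (one-kernel-line incidence uᵀAᵢu + multihomogeneous Bezout
for SMOOTH hypersurfaces:
2^{N−2}C(m,N−1) ≥ d(d−1)^{N−2}); Landsberg2017 §6.4.5–6.4.6 and arXiv  [refs: 10.1016/j.laa.2012.04.043, 10.1007/s00224-025-10253-8, 1907.13611, 2606.11090, 2606.13628, 2604.28019, 1007.3804, 2202.13016, 1004.4802, doi:10.1016/j.laa.2012.04.043, doi:10.1007/s00224-025-10253-8, book:landsberg2017, Landsberg2017, MignonRessayre2004]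

Barriers (technique_class: sdc, gauss-map-factorisation, dual-variety-dimension): - technique_class: sdc, gauss-map-factorisation, dual-variety-dimension
- Literature.Barriers.ValiantsHypothesis.PartialDerivativesDetPerm: not engaged — no flattening rank
of per_n is used anywhere; the invariants are local to points of Z(f) (Hessian rank at a zero,
dimension of the Gauss image, kernel-line geometry of the pencil) and distinguish per from det
already at order 2.
- Literature.Barriers.ValiantsHypothesis.ShiftedPartialsCannotSeparate: formally not engaged (exact
sdc of per_n, not the padded orbit-closure problem, no shifted-partials rank); morally it is the
quadratic ceiling for rank-type measures and SdcPerSq stops exactly there — the bet of SdcPerBeyondN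
/ SdcSuperquadratic is that the class of the dual (an intersection number, multiplicative) or the
sos-length of the symmetric order-4 form is not a flattening rank; honest: it may still stall at N.
- Literature.Barriers.ValiantsHypothesis.RankMethods: technique class = tensor/Waring-rank
certification — does not apply to determinantal size; but the sub-multiplicativity ceiling it
formalises (rank-type measures ≤ poly(#variables)) is the named risk of the order-4 sos-length
child.
- Literature.Barriers.ValiantsHypothesis.RankLifting: same status as RankMethods (lifted rank
methods; not used).
- Literature.Barriers.ValiantsHypothesis.PermanentCharTwo: consistent and respected — everything is
over ℂ; in characteristic 2 per = det has a degenerate dual and xw + yz has no symmetric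
representation at all (GKKP §1.

Novelty grade: new-combination — ROUTE REVIEW (refuter c894e0d7; full text ROUTE-REVIEW.md attached; per-item notes on 5673-5682). 11 decls rc0. Re-derived TRUE: HessianRankSymmDet (rank m+1), OneKernelLine, SdcPerSqPred, SdcOfDc = GKKP Thm 5 (read p.13: 4n³+7 verbatim), Assembly (c'=c+3). SdcPerSq '+1' checked SOUND on paper. NEW  (refuter refuter-rreview-route-CriticalPhenomena--c894e0d7-0, 2026-08-15T14:14:19Z; prior: arxiv:2606.11090;arxiv:1004.4802;MignonRessayre2004;arxiv:1007.3804;AlperBogartVelasco2017)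

History (route lifecycle, newest last):
- 2026-08-16T04:22:05Z · AUTO-CRUX (backfill): SdcThesis — hypotheses of the deciding theorem that nothing in the route derives are cruxes (operator:999:1085951)
- 2026-08-23T02:17:48Z · DORMANT — reconciler: no traction for 5.8 d (last activity item-proof-filed at 2026-08-17T05:24:56Z); parked, not closed — `ledger route dormant route-ValiantsHypothesis- (operator:999:3202511)
- 2026-08-26T05:06:46Z · REACTIVATED — reconciler: reactivated — activity item-proof-filed at 2026-08-26T03:58:33Z after parking at 2026-08-23T02:17:48Z (operator:999:2140688)

sub-problem: ValiantsHypothesis · status: open · opened planner-plancard-ValiantsHypothesis-ValiantsH-d87196a0-0 2026-08-15T11:42:05Z · rev 6 · ledger route-ValiantsHypothesis-SymPencil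
GENERATED by the gate from the ledger (D-0016/17). Provers cite these decls: `theorem foo : Summit.ValiantsHypothesis.ValiantsHypothesis.Theses.SymPencil.<Decl> := …` in Summits/ValiantsHypothesis/ValiantsHypothesis/Theorems/<Name>.lean.
-/

namespace Summit.ValiantsHypothesis.ValiantsHypothesis.Theses.SymPencil

open scoped BigOperators Topology Manifold Classical MeasureTheory ProbabilityTheory Matrix InnerProductSpace ComplexConjugate ContinuousMap
open Filter Set Function TopologicalSpace MeasureTheory

attribute [summit_statement] _root_.ValiantsHypothesis

open Literature.PNP

/-- item stmt-ValiantsHypothesis-5673 · crux (kind.auto-crux: conjecture-grade) · rank 0 · open · by planner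
why it might fail: Via dc ≤ sdc ≤ 4dc³+7 (GKKP Thm 5) X is the Extended Valiant Hypothesis VNP ⊄ VQP in disguise — strictly stronger than VH; it fails if per_n is a qp-projection of DET (dc(per_n) = n^{O(log n)} is compatible with VP ≠ VNP).
sources: arXiv:1007.3804, BurgisserClausenShokrollahi1997, MignonRessayre2004, Grenet2011
[target] X as in § Thesis: no c with sdc(per_n) ≤ 2^((log₂ n + c)^c) for all n (symmetric affine
determinantal representations over ℂ). -/
@[route_item "route-ValiantsHypothesis-SymPencil"]
def SdcThesis : Prop :=
  ¬ ∃ c : ℕ, ∀ n : ℕ, ∃ m ≤ 2 ^ ((Nat.log 2 n + c) ^ c), ∃ A : Matrix (Fin m) (Fin m) (MvPolynomial (Fin n × Fin n) ℂ), A.IsSymm ∧ Literature.Computability.AlgebraicComplexity.IsAffineDetRepr (Literature.Computability.AlgebraicComplexity.perPoly (Fin n) ℂ) A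

/-- item stmt-ValiantsHypothesis-17792 · crux · rank 2 · closed · proved by Summit.ValiantsHypothesis.ValiantsHypothesis.Theorems.SymPencilEquivariantSdcNotQP.Closer.EquivariantSdcNotQP_proof (prover) · by planner
why it might fail: Neither engine covers linear lifts of a torus-free group: LR17's weight chains need the torus, Dawar–Wilsenach's support theorem needs permutation-matrix lifts; perm-ifying a linear lift costs the minimal permutation degree of its constituents — a qp family with a large non-split lift group escapes.
sources: LandsbergRessayre2017, Def 1.3, Thm 2.1, Thm 2.8, Ex 2.5 (arXiv:1508.05788), DawarWilsenach2025, Thm 4.1, Thm 7.1 (arXiv:2002.06451), arXiv:2007.07496, arXiv:1007.3804, Thm 4, Literature.Computability.AlgebraicComplexity.lr_full_equivariant_lower_holds (LandsbergRessayreThm21Proofs.lean), Summit.ValiantsHypothesis.ValiantsHypothesis.Theses.ProofCarryingSymmetry.SquareSymmetricPermLB (stmt-ValiantsHypothesis-10342)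
[crux] X₂ of the finite-symmetry split of the deciding crux SdcThesis (crux-strategist BC2 redirect;
glue SdcThesisOfSubs: SymmetrizePermPairs → EquivariantSdcNotQP → SdcThesis, PROVED in
Cruxes/SdcThesis/Split.lean). EQUIVARIANT LOWER BOUND (a consequence of SdcThesis, the attackable
half): there is no c such that every per_n is det A for a SYMMETRIC affine pencil A of size ≤
2^((log₂ n + c)^c) that is EQUIVARIANT — exact lifts A(γ·x) = g·A(x)·h⁻¹, (g,h) ∈ GL_m × GL_m, tree
IsEquivariantDetRepr (LR17 Def 1.3) — for the finite group Γ_n ≅ 𝔖_n × 𝔖_n of row/column permutation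
pairs (inlined: closure of the permutation matrices of Equiv.prodCongr π ρ; NO torus, on purpose).
Strictly between the two known engines: Landsberg–Ressayre (left torus ⋊ 𝔖_n ⇒ ≥ 2^n − 1; both sides
⇒ C(2n,n) − 1; PROVED in tree lr_left/full_equivariant_lower_holds) needs the diagonal torus for its
weight chains; Dawar–Wilsenach (𝔖_n-symmetric CIRCUITS for per_n have size 2^{Ω(n)} i.o., ToC 2025
Thm 7.1 = route ProofCarryingSymmetry.SquareSymmetricPermLB, stmt-10342) needs PERMUTATION-matrix
lifts. Line of attack (birth skeleton Lines/birth.lean): (i) normalise at the Γ_n-fixed point J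
(per(J) = n! ≠ 0) to conj -/
@[route_item "route-ValiantsHypothesis-SymPencil", crux]
def EquivariantSdcNotQP : Prop :=
  ¬ ∃ c : ℕ, ∀ n : ℕ, ∃ m ≤ 2 ^ ((Nat.log 2 n + c) ^ c), ∃ A : Matrix (Fin m) (Fin m) (MvPolynomial (Fin n × Fin n) ℂ), A.IsSymm ∧ Literature.Computability.AlgebraicComplexity.IsEquivariantDetRepr (Subgroup.closure {γ : GL (Fin n × Fin n) ℂ | ∃ π ρ : Equiv.Perm (Fin n), (γ : Matrix (Fin n × Fin n) (Fin n × Fin n) ℂ) = Equiv.Perm.permMatrix ℂ (Equiv.prodCongr π ρ)}) (Literature.Computability.AlgebraicComplexity.perPoly (Fin n) ℂ) A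

-- `EquivariantSdcNotQP` holds: proved by `Summit.ValiantsHypothesis.ValiantsHypothesis.Theorems.SymPencilEquivariantSdcNotQP.Closer.EquivariantSdcNotQP_proof` (its module imports this route file, so no `_holds` link can be stated here).

/-- item stmt-ValiantsHypothesis-17793 · crux · rank 3 · open · by planner
why it might fail: No symmetrisation mechanism is known (LR17 Q2.2 open; IL17: det_m has rdc O(m³) but equivariant regular reps need 2^m−1). Rigidity gives only CONNECTED-group (torus) symmetry for free; a finite group can permute isolated gauge classes (Grenet-like one-sided pencils: 𝔖_n-orbits of size n!).
sources: LandsbergRessayre2017, Question 2.2, Cor 2.3, Question 2.7, Thm 2.14 (arXiv:1508.05788), IkenmeyerLandsberg2017, §3 (arXiv:1610.00159), arXiv:1007.3804, Thm 4, Thm 5, DwivediPagoSeppelt2026, Outlook Q3, Summit.ValiantsHypothesis.ValiantsHypothesis.Theses.DetQP.DetqpSymmetrization (stmt-ValiantsHypothesis-0319), ledger negatives stmt-ValiantsHypothesis-3735 (GrenetRigidity OptimalUnique refuted: minimal reps are not unique up to gauge)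
[crux] X₁ of the finite-symmetry split of the deciding crux SdcThesis (crux-strategist BC2 redirect;
glue SdcThesisOfSubs: SymmetrizePermPairs → EquivariantSdcNotQP → SdcThesis, PROVED in
Cruxes/SdcThesis/Split.lean). SYMMETRISATION AT QUASI-POLYNOMIAL COST — the symmetric-model,
finite-group form of Landsberg–Ressayre's Question 2.2 (and of DetQP's DetqpSymmetrization 0319 /
ProofCarryingSymmetry's RestorationQP 10343): there is an absolute d such that every SYMMETRIC
affine pencil A of size m with det A = per_n can be replaced by a symmetric affine pencil A' of size
≤ 2^((log₂ m + d)^d), det A' = per_n, that is Γ_n-EQUIVARIANT (exact GL × GL lifts, tree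
IsEquivariantDetRepr) for the row/column permutation pairs Γ_n ≅ 𝔖_n × 𝔖_n. Naive averaging
(symmetrise the ABP of det ∘ A over Γ_n, then GKKP's functorial symmetric representation of
weakly-skew circuits, Thm 4) costs (n!)²·poly(m) — qp(m) only when m ≥ 2^{Ω(√(n log n))}; the
content is the hypothetical small-m regime, i.e. a RIGIDITY statement: small symmetric pencils for
the permanent can be made to respect its finite symmetries cheaply. Not implied by SdcThesis
(sdc(per_n) need not be eventually super-qp) and not implying it w -/
@[route_item "route-ValiantsHypothesis-SymPencil", crux]
def SymmetrizePermPairs : Prop :=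
  ∃ d : ℕ, ∀ (n m : ℕ) (A : Matrix (Fin m) (Fin m) (MvPolynomial (Fin n × Fin n) ℂ)), A.IsSymm → Literature.Computability.AlgebraicComplexity.IsAffineDetRepr (Literature.Computability.AlgebraicComplexity.perPoly (Fin n) ℂ) A → ∃ m' ≤ 2 ^ ((Nat.log 2 m + d) ^ d), ∃ A' : Matrix (Fin m') (Fin m') (MvPolynomial (Fin n × Fin n) ℂ), A'.IsSymm ∧ Literature.Computability.AlgebraicComplexity.IsEquivariantDetRepr (Subgroup.closure {γ : GL (Fin n × Fin n) ℂ | ∃ π ρ : Equiv.Perm (Fin n), (γ : Matrix (Fin n × Fin n) (Fin n × Fin n) ℂ) = Equiv.Perm.permMatrix ℂ (Equiv.prodCongr π ρ)}) (Literature.Computability.AlgebraicComplexity.perPoly (Fin n) ℂ) A'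

/-- item stmt-ValiantsHypothesis-5674 · aside · rank 2 · open · by planner
why it might fail: sdc(per_n) = O(n²) is excluded by nothing: the symmetric model may collapse det-like past the #variables wall (class of Z(per_n)^∨ unknown); n = 4 window 27 ≤ sdc ≤ 29 is calibration only
sources: MignonRessayre2004, arXiv:1007.3804, Landsberg2017
[crux] there is ε > 0 such that, for all large n, every symmetric affine determinantal
representation of per_n over ℂ has size ≥ n^(2+ε) (card item S4: the first bound past the quadratic
/ #variables wall in any determinantal model; sdc-version of DetQP.DetqpSuperquadratic, which
implies it). [deps: SdcPerSq, SdcPerBeyondN] [difficulty: XL] -/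
@[route_item "route-ValiantsHypothesis-SymPencil", crux]
def SdcSuperquadratic : Prop :=
  ∃ ε : ℝ, 0 < ε ∧ ∃ n₀ : ℕ, ∀ n ≥ n₀, ∀ (m : ℕ) (A : Matrix (Fin m) (Fin m) (MvPolynomial (Fin n × Fin n) ℂ)), A.IsSymm → Literature.Computability.AlgebraicComplexity.IsAffineDetRepr (Literature.Computability.AlgebraicComplexity.perPoly (Fin n) ℂ) A → (n : ℝ) ^ (2 + ε) ≤ (m : ℝ)

/-- item stmt-ValiantsHypothesis-5675 · banked · rank 3 · closed · proved by Summit.ValiantsHypothesis.ValiantsHypothesis.Theorems.SymPencilSdcPerSq.sdcPerSq_proof (prover) · by planner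
why it might fail: The final +1 rests on a sketched generic-fibre/cone argument (u_{λx} moves unless A₀u_x = 0; case split on span K) checked only on paper; a gap drops the claim to n² − 1, which is solid (HessianRankSymmDet + rank_mrHess). Formal risk: dual-variety dimension theory is not in Mathlib.
sources: Landsberg2017, MignonRessayre2004, arXiv:1004.4802, arXiv:2606.11090
[crux] for n ≥ 3 every symmetric affine determinantal representation of per_n over ℂ has size ≥ n²
(card S1 sharpened by one). Proof line: one kernel line (OneKernelLine) ⇒ the Gauss image of
Z(per_n) lies in the image of the quadratic map Q(u) = (uᵀAᵢu)ᵢ restricted to the kernel variety K ⊂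
P^{m−1}; Z(per_n)^∨ is a hypersurface (rank Hess per_n = n² at the MR point + Segre Prop 6.4.5.1 +
irreducibility of per_n) ⇒ dim K ≥ n² − 2 ⇒ m ≥ n² − 1; along the cone line λx the tangent
hyperplane is fixed but the kernel u_{λx} = ker(A₀ + λM(x)) moves unless A₀u_x = 0, so either
general fibres of Q|K are ≥ 1-dimensional (m ≥ n²) or A₀ kills span K (A₀ = 0 would make per_n
homogeneous of degree m ≥ n² − 1 > n; span K proper forces dim K ≤ m − 2, again m ≥ n²). [deps:
HessianRankSymmDet, OneKernelLine, SdcPerSqPred] [difficulty: L] -/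
@[route_item "route-ValiantsHypothesis-SymPencil", crux]
def SdcPerSq : Prop :=
  ∀ n : ℕ, 3 ≤ n → ∀ (m : ℕ) (A : Matrix (Fin m) (Fin m) (MvPolynomial (Fin n × Fin n) ℂ)), A.IsSymm → Literature.Computability.AlgebraicComplexity.IsAffineDetRepr (Literature.Computability.AlgebraicComplexity.perPoly (Fin n) ℂ) A → n ^ 2 ≤ m

-- `SdcPerSq` holds: proved by `Summit.ValiantsHypothesis.ValiantsHypothesis.Theorems.SymPencilSdcPerSq.sdcPerSq_proof` (its module imports this route file, so no `_holds` link can be stated here).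

/-- item stmt-ValiantsHypothesis-5676 · aside · rank 4 · closed · proved by Summit.ValiantsHypothesis.ValiantsHypothesis.Theorems.SymPencilSdcPerBeyondN.sdcPerBeyondN_proof (prover) · by planner
why it might fail: At m = n² nothing known obstructs: K = P^{m−1} with Z(per_n)^∨ the image of a quadratic map is consistent, and for n = 3 even the full class (≤ 384 < 2^7·9) cannot exclude a 9×9 symmetric pencil — one such pencil for per_3 refutes the crux as stated (then restate for n ≥ 4).
sources: arXiv:2009.02452, arXiv:2606.11090, AlperBogartVelasco2017, Landsberg2017, arXiv:1007.3804
[crux] for n ≥ 3 every symmetric affine determinantal representation of per_n over ℂ has size ≥ n² +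
1 — the symmetric model crosses the number-of-variables wall (cf. arXiv:2009.02452: the only
explicit dc bound beyond #variables is 1.5n − 3 for power sums). At m = n² the kernel-line geometry
forces K = P^{m−1} and Z(per_n)^∨ = closure of the image of the quadratic map [uᵀAᵢu]: refuting that
structure is the whole content; for n ≥ 4 a near-smooth class of Z(per_n)^∨ (> 2^{n²−2}·n² via
Sheshadri's count extended to singular X) would do it, for n = 3 it cannot (class ≤ 384 < 1152).
[deps: SdcPerSq] [difficulty: L] -/
@[route_item "route-ValiantsHypothesis-SymPencil", crux]
def SdcPerBeyondN : Prop :=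
  ∀ n : ℕ, 3 ≤ n → ∀ (m : ℕ) (A : Matrix (Fin m) (Fin m) (MvPolynomial (Fin n × Fin n) ℂ)), A.IsSymm → Literature.Computability.AlgebraicComplexity.IsAffineDetRepr (Literature.Computability.AlgebraicComplexity.perPoly (Fin n) ℂ) A → n ^ 2 + 1 ≤ m

-- `SdcPerBeyondN` holds: proved by `Summit.ValiantsHypothesis.ValiantsHypothesis.Theorems.SymPencilSdcPerBeyondN.sdcPerBeyondN_proof` (its module imports this route file, so no `_holds` link can be stated here).

/-- item stmt-ValiantsHypothesis-0317 · support · rank 9 · closed · proved by Summit.ValiantsHypothesis.ValiantsHypothesis.Theorems.hubPerNotVp_proof @ 8fd72a57f796 (prover) · by planner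
sources: Valiant1979, Burgisser2000, BurgisserClausenShokrollahi1997
Hub lemma shared by all permanent-based routes: if the permanent family over ℂ is not a VP family
then VP ℂ ≠ VNP ℂ, given the renaming bridge (mem_VP_ofFintype_iff instance) and per ∈ VNP
[Valiant1979; Burgisser2000 Thm 2.10]. Trivial bookkeeping; land once in
Summits/ValiantsHypothesis/Theorems/Hub/. -/
@[route_item "route-ValiantsHypothesis-SymPencil", crux]
def HubPerNotVp : Prop :=
  ¬ Literature.Computability.AlgebraicComplexity.IsVPFamily (fun n => Literature.Computability.AlgebraicComplexity.perPoly (Fin n) ℂ) → (Literature.Computability.AlgebraicComplexity.perFamily ℂ ∈ Literature.Computability.AlgebraicComplexity.VP ℂ ↔ Literature.Computability.AlgebraicComplexity.IsVPFamily (fun n => Literature.Computability.AlgebraicComplexity.perPoly (Fin n) ℂ)) → Literature.Computability.AlgebraicComplexity.perFamily_mem_VNP ℂ → ValiantsHypothesis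

-- `HubPerNotVp` holds: proved by `Summit.ValiantsHypothesis.ValiantsHypothesis.Theorems.hubPerNotVp_proof` @ 8fd72a57f796 (its module imports this route file, so no `_holds` link can be stated here).

/-- item stmt-ValiantsHypothesis-10342 · support · rank 9 · closed · proved by Summit.ValiantsHypothesis.ValiantsHypothesis.Theorems.squareSymmetricPermLB_proof @ ef9c150ea703 (prover) · by planner
[crux] Dawar–Wilsenach's lower bound, size form over ℂ (DawarWilsenach2025 Thm 7.1, which bounds the
maximal ORBIT size, a quantity ≤ size, so the printed theorem is stronger): for every family (C_n)
of S_n-symmetric labelled arithmetic circuits over ℂ (diagonal action on Fin n × Fin n, trivial on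
the single output; DW Defs 2.2, 3.6, 3.7 = tree `LabelledArithCircuit`, `IsSymmetric`) with C_n
computing per_n for every n, the size is not 2^{o(n)}: some ε > 0 has |C_n| ≥ 2^{εn} for infinitely
many n. A published theorem, not yet a Literature fact — filed FIRST so that it lands (as a Theorems
proof or as a named fact the item is then re-filed against) before provers are pointed at the rest.
[difficulty: XL] -/
@[route_item "route-ValiantsHypothesis-SymPencil"]
def SquareSymmetricPermLB : Prop :=
  ∀ (G : ℕ → Type) [∀ n, Fintype (G n)] (C : ∀ n, Literature.Computability.AlgebraicComplexity.LabelledArithCircuit ℂ (Fin n × Fin n) Unit (G n)), (∀ n, (C n).IsSymmetric (Equiv.Perm (Fin n))) → (∀ n, (C n).eval ((C n).output ()) = Literature.Computability.AlgebraicComplexity.perPoly (Fin n) ℂ) → ∃ ε : ℝ, 0 < ε ∧ ∀ n₀ : ℕ, ∃ n ≥ n₀, (2 : ℝ) ^ (ε * n) ≤ Fintype.card (G n)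

/-- `SquareSymmetricPermLB` holds: proved by `Summit.ValiantsHypothesis.ValiantsHypothesis.Theorems.squareSymmetricPermLB_proof` @ ef9c150ea703. -/
theorem SquareSymmetricPermLB_holds : SquareSymmetricPermLB := _root_.Summit.ValiantsHypothesis.ValiantsHypothesis.Theorems.squareSymmetricPermLB_proof

/-- item stmt-ValiantsHypothesis-17813 · support · rank 9 · closed · proved by Summit.ValiantsHypothesis.ValiantsHypothesis.Theorems.SymPencilSdcThesisSplit.sdcThesisOfSubs_proof (prover) · by planner
[support] GLUE of the finite-symmetry split of the deciding crux SdcThesis (crux-strategist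
cstrat-5673, BC2 redirect; `route edit --split` was refused to this seat — "final cycle only" — so
the two children SymmetrizePermPairs (stmt-17793) and EquivariantSdcNotQP (stmt-17792) and this glue
are filed as top-level items; logically SdcThesis is DERIVED from them): SymmetrizePermPairs →
EquivariantSdcNotQP → SdcThesis. PROVED sorry-free: theorem `sdcThesis_of_subs` in
Cruxes/SdcThesis/Split.lean (commit 60f377f21541; rc0, axioms propext/Classical.choice/Quot.sound;
the hypotheses there are the two children's bodies verbatim, so `fun h₁ h₂ => sdcThesis_of_subs h₁
h₂` closes this item by unfolding). Proof: a qp family of symmetric pencils is symmetrised member by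
member (X₁) into a qp family of Γ_n-equivariant symmetric pencils — qp ∘ qp = qp via ((L+c)^c + d)^d
≤ (L + (c+1)(d+1))^{(c+1)(d+1)} (`qpExp_comp`, `qpBound_comp_qpBound`) — which X₂ forbids. A prover
lands Split.lean verbatim as Theorems/SymPencilSdcThesisSplit.lean against this item. [difficulty:
provable-now] Sources: LandsbergRessayre2017 Cor 2.3 (the shape edc-lower-bound + symmetrisation ⇒
separation); Cruxes/SdcThesis/Sp -/
@[route_item "route-ValiantsHypothesis-SymPencil", crux]
def SdcThesisOfSubs : Prop :=
  SymmetrizePermPairs → EquivariantSdcNotQP → SdcThesis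

-- `SdcThesisOfSubs` holds: proved by `Summit.ValiantsHypothesis.ValiantsHypothesis.Theorems.SymPencilSdcThesisSplit.sdcThesisOfSubs_proof` (its module imports this route file, so no `_holds` link can be stated here).

/-- item stmt-ValiantsHypothesis-5677 · support · rank 9 · closed · proved by Summit.ValiantsHypothesis.Theorems.hessianRankSymmDet_proof (prover) · by planner
sources: MignonRessayre2004, CaiChenLi2010, Landsberg2017, arXiv:2202.13016
[support] symmetric Mignon–Ressayre lemma: if f = det A with A a symmetric m×m matrix of
affine-linear forms over ℂ and f(x) = 0, then rank Hess f(x) ≤ m + 1. Proof: congruence normal form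
of the singular symmetric matrix A(x) (det(PᵀMP) = det(P)² det M keeps the pencil symmetric); at
diag(0,1,…,1) the quadratic part of det(Y+Z), Z symmetric, is z₁₁·Σ_{j≥2} z_jj − Σ_{j≥2} z_{1j}², of
rank 2 + (m−1) = m+1; corank 2 gives z₁₁z₂₂ − z₁₂² (rank 3), corank ≥ 3 gives 0; then the affine
chain rule `hessianMatrix_aeval_C_add_linear` (tree) with columns in Sym_m. The dc-analogue in the
tree is rank ≤ 2m (`rank_hessianMatrix_le_two_mul_determinantalComplexity`). [difficulty:
provable-now] -/
@[route_item "route-ValiantsHypothesis-SymPencil", crux]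
def HessianRankSymmDet : Prop :=
  ∀ {N : Type} [Fintype N] (f : MvPolynomial N ℂ) (x : N → ℂ), MvPolynomial.eval x f = 0 → ∀ (m : ℕ) (A : Matrix (Fin m) (Fin m) (MvPolynomial N ℂ)), A.IsSymm → Literature.Computability.AlgebraicComplexity.IsAffineDetRepr f A → (Literature.Computability.AlgebraicComplexity.hessianMatrix f x).rank ≤ m + 1

-- `HessianRankSymmDet` holds: proved by `Summit.ValiantsHypothesis.Theorems.hessianRankSymmDet_proof` (its module imports this route file, so no `_holds` link can be stated here).

/-- item stmt-ValiantsHypothesis-5678 · support · rank 9 · closed · proved by Summit.ValiantsHypothesis.ValiantsHypothesis.Theorems.SymPencilSdcPerSqPred.sdcPerSqPred_proof @ 736b119332e7 (prover) · by planner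
sources: MignonRessayre2004, Landsberg2017, Literature.Computability.AlgebraicComplexity.rank_mrHess (MignonRessayreBound.lean)
[support] the solid fallback of SdcPerSq and the card's S1: for n ≥ 3 every symmetric affine
determinantal representation of per_n has size ≥ n² − 1 — HessianRankSymmDet at the Mignon–Ressayre
zero of per_n where the Hessian has rank n² (tree `rank_mrHess`, `hess0_transl_mrPoint_perPoly`),
exactly as `sq_le_two_mul_of_hasDetRepr_perPoly` does for dc. Already double the dc record n²/2.
[difficulty: provable-now] -/
@[route_item "route-ValiantsHypothesis-SymPencil", crux]
def SdcPerSqPred : Prop :=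
  ∀ n : ℕ, 3 ≤ n → ∀ (m : ℕ) (A : Matrix (Fin m) (Fin m) (MvPolynomial (Fin n × Fin n) ℂ)), A.IsSymm → Literature.Computability.AlgebraicComplexity.IsAffineDetRepr (Literature.Computability.AlgebraicComplexity.perPoly (Fin n) ℂ) A → n ^ 2 ≤ m + 1

-- `SdcPerSqPred` holds: proved by `Summit.ValiantsHypothesis.ValiantsHypothesis.Theorems.SymPencilSdcPerSqPred.sdcPerSqPred_proof` @ 736b119332e7 (its module imports this route file, so no `_holds` link can be stated here).

/-- item stmt-ValiantsHypothesis-5679 · support · rank 9 · closed · proved by Summit.ValiantsHypothesis.ValiantsHypothesis.Theorems.oneKernelLine_proof @ 08cf65c9d381 (prover) · by planner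
sources: arXiv:2606.11090, Landsberg2017
[support] one kernel line (Jacobi's formula + symmetric rank one): if f = det A, A symmetric affine
of size m over ℂ, and f(x) = 0, then there is u ∈ ℂ^m with ∂ᵢf(x) = uᵀAᵢu for every variable i,
where Aᵢ = (coefficient of Xᵢ in A_jl)_jl is the (symmetric) linear part; corank 1: adj A(x) = c·uuᵀ
and √c is absorbed into u; corank ≥ 2: both sides vanish (u = 0). This is the factorisation of the
Gauss map through P^{m−1} that names the card. [difficulty: provable-now] -/
@[route_item "route-ValiantsHypothesis-SymPencil", crux]
def OneKernelLine : Prop :=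
  ∀ {N : Type} [Fintype N] (f : MvPolynomial N ℂ) (m : ℕ) (A : Matrix (Fin m) (Fin m) (MvPolynomial N ℂ)), A.IsSymm → Literature.Computability.AlgebraicComplexity.IsAffineDetRepr f A → ∀ x : N → ℂ, MvPolynomial.eval x f = 0 → ∃ u : Fin m → ℂ, ∀ i : N, MvPolynomial.eval x (MvPolynomial.pderiv i f) = ∑ j, ∑ l, u j * (A j l).coeff (Finsupp.single i 1) * u l

-- `OneKernelLine` holds: proved by `Summit.ValiantsHypothesis.ValiantsHypothesis.Theorems.oneKernelLine_proof` @ 08cf65c9d381 (its module imports this route file, so no `_holds` link can be stated here).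

/-- item stmt-ValiantsHypothesis-5680 · support · rank 9 · closed · proved by Summit.ValiantsHypothesis.ValiantsHypothesis.Theorems.SymPencil.SdcOfDc_proof @ bd04e88ec910 (prover) · by planner
sources: arXiv:1007.3804, GrenetEtAl2011
[support] known transfer (GKKP 2011 Thm 5, Mahajan–Nimbhorkar; Thm 4 for weakly-skew circuits):
DET_m is the determinant of a SYMMETRIC matrix of size 4m³ + 7 whose entries are the variables x_ij
and constants in {0, ±1, 1/2}; substituting the affine entries of any size-m affine determinantal
representation of f gives a symmetric one of size ≤ 4m³ + 7 (pad with an identity block for ≤).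
Makes X ⟺ DetQP.DetqpThesis up to polynomial distortion and is the load-bearing hypothesis of the
Assembly; expected to become a Literature named fact. [difficulty: L] -/
@[route_item "route-ValiantsHypothesis-SymPencil", crux]
def SdcOfDc : Prop :=
  ∀ {N : Type} (f : MvPolynomial N ℂ) (m : ℕ), Literature.Computability.AlgebraicComplexity.HasDetRepr f m → ∃ m' ≤ 4 * m ^ 3 + 7, ∃ A : Matrix (Fin m') (Fin m') (MvPolynomial N ℂ), A.IsSymm ∧ Literature.Computability.AlgebraicComplexity.IsAffineDetRepr f A

-- `SdcOfDc` holds: proved by `Summit.ValiantsHypothesis.ValiantsHypothesis.Theorems.SymPencil.SdcOfDc_proof` @ bd04e88ec910 (its module imports this route file, so no `_holds` link can be stated here).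

/-- item stmt-ValiantsHypothesis-5681 · support · rank 9 · closed · proved by Summit.ValiantsHypothesis.ValiantsHypothesis.Theorems.SymPencilSdcPerThreeTen.sdcPerThreeTen_proof @ 36252abecb54 (prover) · by planner
sources: AlperBogartVelasco2017, arXiv:1007.3804, Grenet2011
[support] the n = 3 instance of SdcPerBeyondN and the route's cheapest finite test: per_3 has no
symmetric affine determinantal representation of size ≤ 9 (dc(per_3) = 7 by AlperBogartVelasco2017;
SdcPerSq gives ≥ 9; an upper bound of a few dozen follows from GKKP Thm 4 on Grenet's 7-vertex ABP
or Thm 3 on Ryser's formula). Refuters: numerical search for a 9×9 symmetric pencil (450 unknowns);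
provers: a certificate that the quadratic map structure Z(per_3)^∨ = image of [uᵀAᵢu] on P^8 is
impossible. [difficulty: M] -/
@[route_item "route-ValiantsHypothesis-SymPencil", crux]
def SdcPerThreeTen : Prop :=
  ∀ (m : ℕ) (A : Matrix (Fin m) (Fin m) (MvPolynomial (Fin 3 × Fin 3) ℂ)), A.IsSymm → Literature.Computability.AlgebraicComplexity.IsAffineDetRepr (Literature.Computability.AlgebraicComplexity.perPoly (Fin 3) ℂ) A → 10 ≤ m

-- `SdcPerThreeTen` holds: proved by `Summit.ValiantsHypothesis.ValiantsHypothesis.Theorems.SymPencilSdcPerThreeTen.sdcPerThreeTen_proof` @ 36252abecb54 (its module imports this route file, so no `_holds` link can be stated here).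

/-- item stmt-ValiantsHypothesis-5682 · assembly · rank 1 · closed · proved by Summit.ValiantsHypothesis.ValiantsHypothesis.Theorems.SymPencil.assembly_proof @ 7c0629a8290b (prover) · by planner
sources: arXiv:1007.3804, BurgisserClausenShokrollahi1997, Valiant1979, Burgisser2000
[assembly] SdcOfDc → SdcThesis → (VP families have qp-bounded dc) → (renaming bridge for the
permanent family) → per ∈ VNP → ValiantsHypothesis. -/
@[route_item "route-ValiantsHypothesis-SymPencil", crux]
def Assembly : Prop :=
  SdcOfDc → SdcThesis → (∀ {σ : ℕ → Type} [∀ n, Fintype (σ n)] (f : ∀ n, MvPolynomial (σ n) ℂ), Literature.Computability.AlgebraicComplexity.IsVPFamily f → Literature.Computability.AlgebraicComplexity.IsQPBounded (fun n => Literature.Computability.AlgebraicComplexity.determinantalComplexity (f n))) → (Literature.Computability.AlgebraicComplexity.perFamily ℂ ∈ Literature.Computability.AlgebraicComplexity.VP ℂ ↔ Literature.Computability.AlgebraicComplexity.IsVPFamily (fun n => Literature.Computability.AlgebraicComplexity.perPoly (Fin n) ℂ)) → Literature.Computability.AlgebraicComplexity.perFamily_mem_VNP ℂ → ValiantsHy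pothesis

-- `Assembly` holds: proved by `Summit.ValiantsHypothesis.ValiantsHypothesis.Theorems.SymPencil.assembly_proof` @ 7c0629a8290b (its module imports this route file, so no `_holds` link can be stated here).

/-! D-0027 §2.1 — DECIDING THEOREM (planner-authored via `route open/edit --closes-file`; by planner-tenure-valiant-dormant-sweep-g1-0 2026-08-27T17:17:59Z):
its hypotheses are this route's items and its conclusion the sub-problem Statement (glue_lint), and it elaborates with this file. -/

@[closes "route-ValiantsHypothesis-SymPencil"] theorem closes : SymmetrizePermPairs → EquivariantSdcNotQP → SdcThesisOfSubs → SdcSuperquadratic → SdcPerSq → SdcPerBeyondN → HubPerNotVp → HessianRankSymmDet → SdcPerSqPred → OneKernelLine → SdcOfDc → SdcPerThreeTen → Assembly → _root_.ValiantsHypothesis := by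
  intro h_SymmetrizePermPairs h_EquivariantSdcNotQP h_SdcThesisOfSubs _h_SdcSuperquadratic _h_SdcPerSq _h_SdcPerBeyondN
    _h_HubPerNotVp _h_HessianRankSymmDet _h_SdcPerSqPred _h_OneKernelLine h_SdcOfDc _h_SdcPerThreeTen h_Assembly
  -- BC2 redirect (tenure g1, A9): the deciding crux `SdcThesis` is DERIVED from its finite-symmetry split
  -- X₁ = SymmetrizePermPairs (stmt-17793) and X₂ = EquivariantSdcNotQP (stmt-17792) through the PROVED glue item
  -- SdcThesisOfSubs (stmt-17813, sdcThesisOfSubs_proof); the other binders are unchanged.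
  have h_SdcThesis : SdcThesis := h_SdcThesisOfSubs h_SymmetrizePermPairs h_EquivariantSdcNotQP
  -- `Assembly` is `SdcOfDc → SdcThesis → (VP families have qp-bounded dc) → (renaming bridge for the
  -- permanent family) → per ∈ VNP → ValiantsHypothesis`; its three Literature hypotheses are PROVED tree
  -- facts (BCS 1997 Cor. (21.40); Bürgisser 2000 Rem. 2.2; Valiant 1979), discharged here by their
  -- `_holds` witnesses, so the deciding theorem rests on the listed items alone.
  exact h_Assembly h_SdcOfDc h_SdcThesis
    (fun f hf =>
      Literature.Computability.AlgebraicComplexity.isQPBounded_determinantalComplexity_of_isVPFamily_holds f hf)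
    (Literature.Computability.AlgebraicComplexity.mem_VP_ofFintype_iff_holds _)
    (Literature.Computability.AlgebraicComplexity.perFamily_mem_VNP_holds ℂ)

end Summit.ValiantsHypothesis.ValiantsHypothesis.Theses.SymPencil
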